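import Literature.NumberTheory.EllipticCurves.MordellWeilRankZeroProofs
import Literature.NumberTheory.EllipticCurves.VariableChangePoints
import HarnessLib

/-!
# Road (C) `disegni-pair-two` on crux stmt-BirchSwinnertonDyer-20368 — FRAME, Mordell–Weil pieces

LEAD `bsd-line-cf2-p1` g21, for the registered stub `stub_frame_two` of `Lines/disegni_pair_two.lean` (v3):
the frame's clauses «`P` generates `V^{(d*)}(ℚ)` modulo torsion» and «every point of the companion twist is
torsion» are produced here from the Mordell–Weil RANK alone (the tree's Mordell–Weil theorem
`WeierstrassCurve.module_finite_point_holds` / `exists_isMordellWeilBasis_holds` / `finite_point_of_rank_zero`),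
plus their transport along an admissible change of variables. THEOREMS ONLY; no `sorry`; no new definitions.
BSD is not proved by any of this; 20368 is not closed here.
-/

set_option linter.dupNamespace false

noncomputable section

open scoped Classical

open WeierstrassCurve

namespace Summit.BirchSwinnertonDyer.BirchSwinnertonDyer.Theorems.PrintCf2.DisegniPairTwo

variable {K : Type*} [Field K] [NumberField K] (X : WeierstrassCurve K) [X.IsElliptic]

/-- **A generator modulo torsion from rank one.** If `rank_ℤ X(K) = 1` then there is a point `P ∈ X(K)` of
infinite order such that every `R ∈ X(K)` is `k • P + T` with `k ∈ ℤ` and `T` torsion (Mordell–Weil: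
`X(K) ≅ X(K)_tors × ℤ`, the tree's `exists_isMordellWeilBasis_holds`). [cite: SilvermanAEC2009, Thm. VIII.6.7 and Ch. VIII intro] -/
theorem exists_generator_modTorsion_of_mordellWeilRank_eq_one (h : X.mordellWeilRank = 1) :
    ∃ P : X.toAffine.Point, ¬ IsOfFinAddOrder P ∧
      ∀ R : X.toAffine.Point, ∃ (k : ℤ) (T : X.toAffine.Point), IsOfFinAddOrder T ∧ R = k • P + T := by
  obtain ⟨B, hBli, hBsp⟩ := X.exists_isMordellWeilBasis_holds
  let i0 : Fin X.mordellWeilRank := ⟨0, by omega⟩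
  have hsub : ∀ i : Fin X.mordellWeilRank, i = i0 := fun i => Fin.ext (by have := i.2; simp only [i0]; omega)
  refine ⟨B i0, ?_, fun R => ?_⟩
  · -- the image of `B i0` in `X(K)/tors` is part of a `ℤ`-basis, hence non-zero
    intro hfin
    have hmem : B i0 ∈ AddCommGroup.torsion X.toAffine.Point := (AddCommGroup.mem_torsion _).mpr hfin
    have h0 : (QuotientAddGroup.mk (B i0) : mordellWeilModTorsion X) = 0 :=
      (QuotientAddGroup.eq_zero_iff _).mpr hmem
    have hne := hBli.ne_zero i0
    exact hne (by simpa using h0)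
  · have hR : (QuotientAddGroup.mk R : mordellWeilModTorsion X) ∈
        Submodule.span ℤ (Set.range (QuotientAddGroup.mk ∘ B : Fin X.mordellWeilRank → mordellWeilModTorsion X)) := by
      rw [hBsp]; exact Submodule.mem_top
    have hrange : Set.range (QuotientAddGroup.mk ∘ B : Fin X.mordellWeilRank → mordellWeilModTorsion X) =
        {(QuotientAddGroup.mk (B i0) : mordellWeilModTorsion X)} := by
      ext x
      simp only [Set.mem_range, Function.comp_apply, Set.mem_singleton_iff]
      constructor
      · rintro ⟨i, rfl⟩
        rw [hsub i]
      · rintro rfl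
        exact ⟨i0, rfl⟩
    rw [hrange, Submodule.mem_span_singleton] at hR
    obtain ⟨k, hk⟩ := hR
    refine ⟨k, R - k • B i0, ?_, by abel⟩
    rw [← AddCommGroup.mem_torsion, ← QuotientAddGroup.eq_zero_iff]
    rw [QuotientAddGroup.mk_sub, QuotientAddGroup.mk_zsmul, ← hk, sub_self]

/-- **Rank zero: every rational point is torsion** (Mordell–Weil, `finite_point_of_rank_zero`).
[cite: SilvermanAEC2009, Thm. VIII.6.7 and Ch. VIII intro] -/
theorem isOfFinAddOrder_of_mordellWeilRank_eq_zero (h : X.mordellWeilRank = 0) (Q : X.toAffine.Point) :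
    IsOfFinAddOrder Q := by
  haveI : Finite X.toAffine.Point := X.finite_point_of_rank_zero h
  exact isOfFinAddOrder_of_finite Q

omit [NumberField K] [X.IsElliptic] in
/-- Torsion is transported along an additive equivalence of point groups. [folklore] -/
theorem isOfFinAddOrder_iff_of_addEquiv {Y : WeierstrassCurve K} (e : X.toAffine.Point ≃+ Y.toAffine.Point)
    (Q : X.toAffine.Point) : IsOfFinAddOrder (e Q) ↔ IsOfFinAddOrder Q :=
  e.injective.isOfFinAddOrder_iff (f := e.toAddMonoidHom)

omit [NumberField K] [X.IsElliptic] in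
/-- **Generator modulo torsion transported along a change of variables** `C • X = Y`: if `P` generates `X(K)`
modulo torsion then its image under `VariableChange.pointEquiv` generates `Y(K)` modulo torsion.
[cite: SilvermanAEC2009, III.3.1(b)] -/
theorem exists_generator_modTorsion_of_smul_eq {Y : WeierstrassCurve K} (C : VariableChange K) (hC : C • X = Y)
    (h : ∃ P : X.toAffine.Point, ¬ IsOfFinAddOrder P ∧
      ∀ R : X.toAffine.Point, ∃ (k : ℤ) (T : X.toAffine.Point), IsOfFinAddOrder T ∧ R = k • P + T) :
    ∃ P : Y.toAffine.Point, ¬ IsOfFinAddOrder P ∧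
      ∀ R : Y.toAffine.Point, ∃ (k : ℤ) (T : Y.toAffine.Point), IsOfFinAddOrder T ∧ R = k • P + T := by
  subst hC
  obtain ⟨P, hP, hgen⟩ := h
  let e := VariableChange.pointEquiv X C
  refine ⟨e P, fun hfin => hP ((isOfFinAddOrder_iff_of_addEquiv X e P).mp hfin), fun R => ?_⟩
  obtain ⟨k, T, hT, hR⟩ := hgen (e.symm R)
  refine ⟨k, e T, (isOfFinAddOrder_iff_of_addEquiv X e T).mpr hT, ?_⟩
  have := congrArg e hR
  rw [AddEquiv.apply_symm_apply] at this
  rw [this, map_add, map_zsmul]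

omit [NumberField K] [X.IsElliptic] in
/-- **All points torsion, transported along a change of variables** `C • X = Y`. [cite: SilvermanAEC2009, III.3.1(b)] -/
theorem forall_isOfFinAddOrder_of_smul_eq {Y : WeierstrassCurve K} (C : VariableChange K) (hC : C • X = Y)
    (h : ∀ Q : X.toAffine.Point, IsOfFinAddOrder Q) (Q : Y.toAffine.Point) : IsOfFinAddOrder Q := by
  subst hC
  let e := VariableChange.pointEquiv X C
  have := h (e.symm Q)
  rwa [← isOfFinAddOrder_iff_of_addEquiv X e, AddEquiv.apply_symm_apply] at this

end Summit.BirchSwinnertonDyer.BirchSwinnertonDyer.Theorems.PrintCf2.DisegniPairTwo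

end
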